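import Summits.BirchSwinnertonDyer.BirchSwinnertonDyer.Theorems.CMKolyvaginAtInertTwoCMKolyvaginConjectureAtInertTwoPositiveDepthPrimeLevel
import HarnessLib

/-!
# Crux `CMKolyvaginConjectureAtInertTwo` (stmt-BirchSwinnertonDyer-24648), open stub `stub_positiveDepth`:
# THE CANONICAL FORM AT PRIME LEVEL — `P(ℓ) ∈ 2E(K[ℓ]) ⟺ y_χ ∈ 4E(K[ℓ])` for the genus-character point `y_χ`

Route `CMKolyvaginAtInertTwo` (cell `pub/bsd-eis`, seat `leafhand-bsd-cmkolyvaginatinert-1` g0); helper (`--supports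
stmt-BirchSwinnertonDyer-24648 --as helper`). THEOREMS ONLY (no definition, no named fact, no `sorry`); closes nothing;
BSD is proved for no curve. Sequel of `…PositiveDepthPrimeLevel.lean` (p794939).

WHAT. p794939 reduced the open stub at a CM-inert Kolyvagin prime `ℓ` to the `4`-divisibility of the transversal sum
`Σ_{s ∈ S} s(Y_χ)`, `Y_χ = Σ_{i ≤ ℓ} (−1)^i σ_ℓ^i y(ℓ)`, which still mentions the datum's choices `S`, `σ_ℓ`. Here the
choices disappear: for ANY function `χ` on `Gal(K[ℓ]/ℚ)` with `χ(gσ_ℓ) = −χ(g)` and values `±1` on `𝒢_ℓ = Gal(K[ℓ]/K)`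
(a genus character of the order of conductor `ℓ` that is odd on `G_ℓ` — HYPOTHESIS, its existence is genus theory),
the CANONICAL point `y_χ := Σ_{g ∈ 𝒢_ℓ} χ(g)·g y(ℓ)` (a `Σᶠ` over the whole group) satisfies
**`P(ℓ) ∈ 2E(K[ℓ]) ⟺ y_χ ∈ 4E(K[ℓ])`** (`two_dvd_derivedPoint_iff_four_dvd_chiSum`).

* §1 (pure group bookkeeping) `finsum_mem_eq_sum_transversal_sum_range`: `𝒢 = S·⟨σ⟩` — a `𝒢`-indexed `Σᶠ` splits as
  `Σ_{s ∈ S} Σ_{i < ord σ}` for a transversal `S` of `⟨σ⟩` in `𝒢`; `finsum_chi_smul_eq_sum_transversal`: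
  `Σᶠ_{g∈𝒢} χ(g)·g y = Σ_s χ(s)·s(Y_χ)`; `exists_four_zsmul_finsum_chi_sub_sum`: `≡ Σ_s s(Y_χ) (mod 4)` when the trace
  `Σ_i σ^i y` vanishes (`Y_χ = −2·Σ_{odd}`, `χ(s) − 1 ∈ {0, −2}`).
* §2 the instance on an H₂ frame at a CM-inert Kolyvagin prime (trace vanishing and `E(K[ℓ])[2] = 0` from p794939).

By Gross–Zagier for ring-class characters the height of `y_χ` is an `L'·L`-product over the genus pair attached to
`χ` — so at prime level the open stub reads: a genus-character Heegner point on a CM curve is not `4`-divisible.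
HONEST FRAMING: composition of tree theorems + elementary group sums; the open mathematics is untouched.
[cite: GrossLMS1991, §3 (3.5), Prop. 3.7 (1), §4 (4.1)] [cite: Cox2013, §7.D Thm. 7.24, §9.A]
-/

set_option linter.dupNamespace false -- `Summit.BirchSwinnertonDyer.BirchSwinnertonDyer.Theorems.…` (summit = sub)
set_option autoImplicit false

noncomputable section

open scoped Classical

namespace Summit.BirchSwinnertonDyer.BirchSwinnertonDyer.Theorems.CMKolyvaginConjecturePositiveDepth

open Finset

section Algebra

variable {G : Type*} [Group G] {A : Type*} [AddCommGroup A] (ρ : G →* AddMonoid.End A)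

/-- **`𝒢 = S · ⟨σ⟩` as a sum**: for a subgroup `𝒢`, an element `σ ∈ 𝒢` of finite order `m`, and a system `S ⊆ 𝒢` of
representatives of `𝒢/⟨σ⟩` (`∀ g ∈ 𝒢, ∃! s ∈ S, g⁻¹ s ∈ ⟨σ⟩`), every `𝒢`-indexed sum splits as
`Σᶠ_{g ∈ 𝒢} f g = Σ_{s ∈ S} Σ_{i < m} f (s σ^i)`. [folklore] -/
theorem finsum_mem_eq_sum_transversal_sum_range {M : Type*} [AddCommMonoid M] (𝒢 : Subgroup G) (σ : G)
    (hσ𝒢 : σ ∈ 𝒢) {m : ℕ} (hm : orderOf σ = m) (hm0 : m ≠ 0) (S : Finset G) (hS : ∀ s ∈ S, s ∈ 𝒢)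
    (hT : ∀ g ∈ 𝒢, ∃! s, s ∈ S ∧ g⁻¹ * s ∈ Subgroup.zpowers σ) (f : G → M) :
    ∑ᶠ g ∈ (𝒢 : Set G), f g = ∑ s ∈ S, ∑ i ∈ range m, f (s * σ ^ i) := by
  classical
  have hfin : IsOfFinOrder σ := orderOf_pos_iff.mp (by omega)
  have hpow : ∀ {g : G}, g ∈ Subgroup.zpowers σ → ∃ i < m, σ ^ i = g := fun {g} hg ↦ by
    obtain ⟨i, hi, hiσ⟩ : ∃ i ∈ Finset.range (orderOf σ), σ ^ i = g := by
      simpa [Finset.mem_image] using (hfin.mem_zpowers_iff_mem_range_orderOf).mp hg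
    exact ⟨i, by rw [Finset.mem_range, hm] at hi; exact hi, hiσ⟩
  -- `𝒢` is the image of `S × [0, m)` under `(s, i) ↦ s σ^i`
  have hset : (𝒢 : Set G) = ↑((S ×ˢ range m).image (fun p : G × ℕ ↦ p.1 * σ ^ p.2)) := by
    ext g
    simp only [SetLike.mem_coe, Finset.coe_image, Finset.coe_product, Finset.coe_range, Set.mem_image,
      Set.mem_prod, Set.mem_Iio, Prod.exists]
    constructor
    · intro hg
      obtain ⟨s, ⟨hsS, hs⟩, -⟩ := hT g hg
      obtain ⟨i, hi, hiσ⟩ := hpow hs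
      refine ⟨s, (m - i) % m, ⟨hsS, Nat.mod_lt _ (by omega)⟩, ?_⟩
      have hinv : (σ ^ i)⁻¹ = σ ^ (m - i) := by
        refine inv_eq_of_mul_eq_one_right ?_
        rw [← pow_add, Nat.add_sub_cancel' hi.le, ← hm, pow_orderOf_eq_one]
      have hmod : σ ^ ((m - i) % m) = σ ^ (m - i) := by rw [← hm, pow_mod_orderOf]
      rw [hmod, ← hinv, hiσ, mul_inv_rev, inv_inv, mul_inv_cancel_left]
    · rintro ⟨s, i, ⟨hsS, -⟩, rfl⟩
      exact 𝒢.mul_mem (hS s hsS) (𝒢.pow_mem hσ𝒢 i)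
  have hinj : Set.InjOn (fun p : G × ℕ ↦ p.1 * σ ^ p.2) ↑(S ×ˢ range m) := by
    rintro ⟨s, i⟩ hp ⟨s', j⟩ hp' h
    simp only [Finset.coe_product, Finset.coe_range, Set.mem_prod, Finset.mem_coe, Set.mem_Iio] at hp hp'
    simp only at h
    have hss' : s⁻¹ * s' ∈ Subgroup.zpowers σ := by
      have : s⁻¹ * s' = σ ^ i * (σ ^ j)⁻¹ := by
        rw [eq_mul_inv_iff_mul_eq, mul_assoc, ← h, inv_mul_cancel_left]
      rw [this]
      exact Subgroup.mul_mem _ (Subgroup.npow_mem_zpowers σ i) (Subgroup.inv_mem _ (Subgroup.npow_mem_zpowers σ j))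
    have hs1 : s⁻¹ * s ∈ Subgroup.zpowers σ := by rw [inv_mul_cancel]; exact Subgroup.one_mem _
    have hs : s = s' := ((hT s (hS s hp.1)).unique ⟨hp.1, hs1⟩ ⟨hp'.1, hss'⟩).symm ▸ rfl
    subst hs
    have hij : σ ^ i = σ ^ j := mul_left_cancel h
    have := pow_injOn_Iio_orderOf (Set.mem_Iio.mpr (hm ▸ hp.2)) (Set.mem_Iio.mpr (hm ▸ hp'.2)) hij
    simp [this]
  rw [hset, finsum_mem_coe_finset, Finset.sum_image hinj, Finset.sum_product]

/-- `χ(s σ^i) = (−1)^i χ(s)` for a function with `χ(g σ) = −χ(g)`. [folklore] -/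
theorem chi_mul_pow (σ : G) (χ : G → ℤ) (hχ : ∀ g, χ (g * σ) = -χ g) (s : G) (i : ℕ) :
    χ (s * σ ^ i) = (-1) ^ i * χ s := by
  induction i with
  | zero => simp
  | succ i ih => rw [pow_succ, ← mul_assoc, hχ, ih, pow_succ]; ring

/-- **The `χ`-twisted `𝒢`-sum is the transversal sum of the genus-character sums**: with `𝒢 = S·⟨σ⟩` as above and
`χ(gσ) = −χ(g)`: `Σᶠ_{g ∈ 𝒢} χ(g)·ρ(g) y = Σ_{s ∈ S} χ(s)·ρ(s)(Σ_{i<m} (−1)^i ρ(σ^i) y)`. [folklore] -/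
theorem finsum_chi_smul_eq_sum_transversal (𝒢 : Subgroup G) (σ : G) (hσ𝒢 : σ ∈ 𝒢) {m : ℕ}
    (hm : orderOf σ = m) (hm0 : m ≠ 0) (S : Finset G) (hS : ∀ s ∈ S, s ∈ 𝒢)
    (hT : ∀ g ∈ 𝒢, ∃! s, s ∈ S ∧ g⁻¹ * s ∈ Subgroup.zpowers σ) (χ : G → ℤ) (hχ : ∀ g, χ (g * σ) = -χ g)
    (y : A) :
    ∑ᶠ g ∈ (𝒢 : Set G), χ g • ρ g y =
      ∑ s ∈ S, χ s • ρ s (∑ i ∈ range m, ((-1 : ℤ) ^ i) • ρ (σ ^ i) y) := by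
  rw [finsum_mem_eq_sum_transversal_sum_range 𝒢 σ hσ𝒢 hm hm0 S hS hT]
  refine Finset.sum_congr rfl fun s _ ↦ ?_
  rw [map_sum, Finset.smul_sum]
  refine Finset.sum_congr rfl fun i _ ↦ ?_
  rw [chi_mul_pow σ χ hχ s i, map_zsmul, smul_smul, map_mul, mul_comm]
  rfl

/-- **`Σ (−1)^i x_i + 2 Σ_{i odd} x_i = Σ x_i`.** [folklore] -/
theorem sum_neg_one_pow_smul_add_two_smul_sum_filter_odd (n : ℕ) (x : ℕ → A) :
    ∑ i ∈ range n, ((-1 : ℤ) ^ i) • x i + (2 : ℤ) • ∑ i ∈ (range n).filter Odd, x i = ∑ i ∈ range n, x i := by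
  rw [Finset.sum_filter, Finset.smul_sum, ← Finset.sum_add_distrib]
  refine Finset.sum_congr rfl fun i _ ↦ ?_
  rcases Nat.even_or_odd i with hi | hi
  · rw [hi.neg_one_pow, if_neg (Nat.not_odd_iff_even.mpr hi), smul_zero, add_zero, one_smul]
  · rw [hi.neg_one_pow, if_pos hi, neg_one_smul, two_smul]; abel

/-- **The `χ`-twisted `𝒢`-sum ≡ the plain transversal sum of the genus-character sum (mod `4`)** when the trace
`Σ_{i<m} ρ(σ^i) y` vanishes and `χ` takes values `±1` on `S`: then each `ρ(s)(Y_χ)`, `Y_χ = Σ (−1)^i ρ(σ^i) y = −2 Σ_{odd}`,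
is `2`-divisible, and `χ(s) − 1 ∈ {0, −2}`. [folklore] -/
theorem exists_four_zsmul_finsum_chi_sub_sum (𝒢 : Subgroup G) (σ : G) (hσ𝒢 : σ ∈ 𝒢) {m : ℕ}
    (hm : orderOf σ = m) (hm0 : m ≠ 0) (S : Finset G) (hS : ∀ s ∈ S, s ∈ 𝒢)
    (hT : ∀ g ∈ 𝒢, ∃! s, s ∈ S ∧ g⁻¹ * s ∈ Subgroup.zpowers σ) (χ : G → ℤ) (hχ : ∀ g, χ (g * σ) = -χ g)
    (hχ1 : ∀ s ∈ S, χ s = 1 ∨ χ s = -1) (y : A) (htr : ∑ i ∈ range m, ρ (σ ^ i) y = 0) :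
    ∃ R : A, (4 : ℤ) • R = ∑ᶠ g ∈ (𝒢 : Set G), χ g • ρ g y -
      ∑ s ∈ S, ρ s (∑ i ∈ range m, ((-1 : ℤ) ^ i) • ρ (σ ^ i) y) := by
  rw [finsum_chi_smul_eq_sum_transversal ρ 𝒢 σ hσ𝒢 hm hm0 S hS hT χ hχ y, ← Finset.sum_sub_distrib]
  set Y := ∑ i ∈ range m, ((-1 : ℤ) ^ i) • ρ (σ ^ i) y with hY
  set Z := ∑ i ∈ (range m).filter Odd, ρ (σ ^ i) y with hZ
  have hY2 : Y = -((2 : ℤ) • Z) := by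
    have h := sum_neg_one_pow_smul_add_two_smul_sum_filter_odd (A := A) m (fun i ↦ ρ (σ ^ i) y)
    rw [htr] at h
    exact eq_neg_of_add_eq_zero_left h
  have hterm : ∀ s ∈ S, ∃ t : A, χ s • ρ s Y - ρ s Y = (4 : ℤ) • t := fun s hs ↦ by
    rcases hχ1 s hs with h | h
    · exact ⟨0, by rw [h, one_smul, sub_self, smul_zero]⟩
    · refine ⟨ρ s Z, ?_⟩
      rw [h, hY2, map_neg, map_zsmul, neg_one_smul]
      module
  choose! t ht using hterm
  exact ⟨∑ s ∈ S, t s, by rw [Finset.smul_sum]; exact Finset.sum_congr rfl fun s hs ↦ (ht s hs).symm⟩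

end Algebra

section Heegner

open WeierstrassCurve NumberField Literature.NumberTheory.EllipticCurves
  Literature.NumberTheory.EllipticCurves.ModularForms Literature.NumberTheory.EllipticCurves.Rank1Residual
  Summit.BirchSwinnertonDyer.BirchSwinnertonDyer.Theorems

variable {K : Type} [Field K] [NumberField K]

/-- **`P(ℓ) ∈ 2E(K[ℓ]) ⟺ y_χ ∈ 4E(K[ℓ])` for the CANONICAL genus-character Heegner point
`y_χ = Σ_{g ∈ Gal(K[ℓ]/K)} χ(g)·g y(ℓ)`.** Frame of the stub (CM, `CMInert W 2`, `ρ̄_{W,2}` onto, `K` with odd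
`d_K ≠ −3`, Heegner for `N_E`), `ℓ` a Zhang–Kolyvagin prime at `2` inert in `F`, `d` ANY datum of conductor `ℓ`, and
`χ : Gal(K[ℓ]/ℚ) → ℤ` any function with `χ(g σ_ℓ) = −χ(g)` and values `±1` on `𝒢_ℓ = Gal(K[ℓ]/K)` (a genus character of
the order of conductor `ℓ`, odd on `G_ℓ`; its existence is genus theory and is NOT asserted here). Then the
`2`-divisibility of the derived point `P(ℓ)` is the `4`-divisibility of `y_χ` — a sum over the WHOLE group `𝒢_ℓ`,
independent of the transversal `S` and of the generator. Ingredients: p794939's `two_dvd_derivedPoint_iff_four_dvd_genusPoint`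
and `sum_range_pointGalHom_σ_pow_y_eq_zero`, and `𝒢_ℓ = S·⟨σ_ℓ⟩` (`finsum_mem_eq_sum_transversal_sum_range`).
[cite: GrossLMS1991, §3 (3.5), Prop. 3.7 (1), §4 (4.1)] [cite: Cox2013, §7.D Thm. 7.24, §9.A (ring class groups)] -/
theorem two_dvd_derivedPoint_iff_four_dvd_chiSum (W : WeierstrassCurve ℚ) [W.IsElliptic]
    [W.IsGloballyMinimal] [NeZero (W.conductorNorm ℤ)] (hCM : W.HasCM) (hin : CMInert W 2)
    (hρ : W.HasSurjectiveModNGaloisRep (2 : ℤ)) (hK : IsImaginaryQuadratic K)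
    (hodd : Odd (NumberField.discr K)) (h3 : NumberField.discr K ≠ -3)
    (hH : SatisfiesHeegnerHypothesis (W.conductorNorm ℤ) K)
    {Dt : ModularParametrizationData W (W.conductorNorm ℤ)} {β : ℤ} {ι : K →+* ℂ} {ℓ : ℕ}
    (hℓK : Zhang2014.IsKolyvaginPrime (W.conductorNorm ℤ) W K 2 ℓ) (hℓF : CMInert W ℓ)
    (d : KolyvaginHeegnerData Dt β ι ℓ)
    (χ : (ringClassField K ι ℓ ≃ₐ[ℚ] ringClassField K ι ℓ) → ℤ) (hχ : ∀ g, χ (g * d.σ ℓ) = -χ g)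
    (hχ1 : ∀ g ∈ ringClassGal ι ℓ, χ g = 1 ∨ χ g = -1) :
    (∃ Q : (W.baseChange (ringClassField K ι ℓ)).toAffine.Point, (2 : ℤ) • Q = d.derivedPoint) ↔
      ∃ R : (W.baseChange (ringClassField K ι ℓ)).toAffine.Point, (4 : ℤ) • R =
        ∑ᶠ g ∈ (ringClassGal ι ℓ : Set (ringClassField K ι ℓ ≃ₐ[ℚ] ringClassField K ι ℓ)),
          χ g • pointGalHom W (ringClassField K ι ℓ) g d.y := by
  have hℓ := hℓK.1
  have hinert : (Ideal.span {(ℓ : 𝓞 K)}).IsPrime := hℓK.2.2.2.2.1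
  have hℓℓ : ℓ ∈ ℓ.primeFactors := Nat.mem_primeFactors.mpr ⟨hℓ, dvd_rfl, hℓ.ne_zero⟩
  have hG : ringClassGalOver ι ℓ 1 = Subgroup.zpowers (d.σ ℓ) := by
    rw [d.zpowers_σ ℓ hℓℓ, Nat.div_self hℓ.pos]
  have hσ𝒢 : d.σ ℓ ∈ ringClassGal ι ℓ :=
    ringClassGalOver_le_ringClassGal ι ℓ 1 (by rw [hG]; exact Subgroup.mem_zpowers _)
  have hord := orderOf_σ_eq_succ_of_prime W hK hodd h3 hℓ hinert d
  obtain ⟨R₀, hR₀⟩ := exists_four_zsmul_finsum_chi_sub_sum (pointGalHom W (ringClassField K ι ℓ))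
    (ringClassGal ι ℓ) (d.σ ℓ) hσ𝒢 hord (Nat.succ_ne_zero ℓ) d.S d.S_subset
    (fun g hg ↦ by simpa only [hG] using d.S_transversal g hg) χ hχ (fun s hs ↦ hχ1 s (d.S_subset s hs)) d.y
    (sum_range_pointGalHom_σ_pow_y_eq_zero W hCM hK hodd h3 hH hℓK hℓF d)
  rw [two_dvd_derivedPoint_iff_four_dvd_genusPoint W hCM hin hρ hK hodd h3 hH hℓK hℓF d]
  rw [eq_sub_iff_add_eq] at hR₀
  constructor
  · rintro ⟨R, hR⟩
    exact ⟨R₀ + R, by rw [smul_add, hR, hR₀]⟩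
  · rintro ⟨R, hR⟩
    exact ⟨R - R₀, by rw [smul_sub, hR, ← hR₀, add_sub_cancel_left]⟩

end Heegner

end Summit.BirchSwinnertonDyer.BirchSwinnertonDyer.Theorems.CMKolyvaginConjecturePositiveDepth

end
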